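/-
Copyright (c) 2026 the pub-hodgecm-mathlib formalisation cell (harness21).  Prover seat hodgecm-mathlib-A-p12 (g22), 2026-09-01.  Road «S3-tree» (architect A-p16 (g30)
A-152): R2² sub-head (D1) «ONE-PLACE DATA OF A TYPE-(2) MATCH» — part 1∕2, the GENERIC matrix algebra (part 2∕2 = `TypeTwoOnePlaceData.lean`, the CM assembly).
-/
import Literature.NumberTheory.Automorphic.TypeTwoCommutantBridge                      -- ★ p846662 (D3) (A-p19 (g26)): `aeval_mulVec_eq_krylov_mulVec` (Krylov action of a polynomial)
import HarnessLib

/-!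
# (D1) part 1∕2 — generic algebra of a type-(2) match: the `2 × 2` unitary torus identities, the cubic `(X − u)(X² − tX + D)`, a cyclic vector, the non-isotropic eigenline
(Rogawski (1990) §3.1 p. 19, §3.5 Prop. 3.5.2 (c) p. 29; Horn–Johnson §3.3)

Topic `NumberTheory/Rogawski1990`; namespace `Literature.NumberTheory.Rogawski1990`.  THEOREMS ONLY (no definition, no instance, no notation, no named fact, no `sorry`); kernel lane
`--supports stmt-HodgeConjecture-24833`.  Cell `pub/hodgecm-mathlib`, crux H413; road «S3-tree», T3′ «depth-zero κ-transfer», ROW 2 of the type-(2) socket (R2², holder A-p19 (g26)),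
sub-head **(D1)** (A-152 → A-p12 (g22)); this file holds the four GENERIC lemmas the CM assembly `exists_typeTwo_onePlace_data` (part 2∕2) uses, over an arbitrary field `K`
with a ring endomorphism `σ`:
* §1 for `A ∈ M₂(K)` unitary for the antidiagonal form (`ᵗ(σA)·antidiag(1,1)·A = antidiag(1,1)`): `det A · σ(det A) = 1` and `σ(tr A) · det A = tr A` (four entry identities and
  `linear_combination`);
* §2 the cubic tokens `1·X³ − (t+u)X² + (D+tu)X − uD = (X − u)(X² − tX + D)`, its coefficients `1, 2`, `coeff₂ (charpoly 1) = −3`, and `χ(τ)x = χ(u)x` on a `u`-eigenvector;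
* §3 **a CYCLIC VECTOR** for `τ ∈ M₃(K)` with `charpoly τ = (X − u)·χ`, `χ` an irreducible quadratic: any `w` with `τw ≠ uw` and `χ(τ)w ≠ 0` has invertible Krylov matrix (the `gcd` of a
  degree-`≤ 2` annihilator with `(X − u)χ` is `1`, `X − u` or `χ` up to units — ★ (D3) `aeval_mulVec_eq_krylov_mulVec`, `EuclideanDomain.gcd_eq_gcd_ab`), and such a `w` exists off the
  union of the two proper kernels (`exists_mulVec_ne_smul_of_charpoly`: `τ ≠ u·1` since `χ(u) ≠ 0`);
* §4 **NON-ISOTROPY OF THE `u`-EIGENLINE**: for `τ` unitary for an invertible `J` (`ᵗ(στ)Jτ = J`), `σu·u = 1`, `P = τ² − tτ + D = p qᵀ`, `χ(u) ≠ 0` and the eigen-column `x = q_j p ≠ 0`: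
  `x*Jx ≠ 0` (the row `ℓ = (σx)ᵀJ` is a left `u`-eigenvector with `ℓP = χ(u)ℓ = (ℓ·p)qᵀ`).
HONEST LABEL: HC_CM is proved only modulo the 2 remaining named inputs (hLiu418 24832, h413 24833) until rung 0 closes; this file discharges no named fact.

## References
* [Rogawski1990] J. D. Rogawski, *Automorphic Representations of Unitary Groups in Three Variables*, Ann. of Math. Stud. 123 (1990): §3.1 p. 19; §3.5 Prop. 3.5.2 (c) p. 29;
  §4.3 (4.3.2) p. 43.
* [HornJohnson2013] R. A. Horn, C. R. Johnson, *Matrix Analysis*, 2nd ed. (2013): §0.8.2, §1.1, Thm. 1.1.6, Thm. 2.4.3.2, §3.3 Thm. 3.3.15.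
* [Lang2002] S. Lang, *Algebra*, 3rd ed., GTM 211 (2002): Ch. XIV §2 Thm. 2.1, §3.
-/

set_option autoImplicit false

noncomputable section

open Matrix Polynomial
open scoped Matrix MatrixGroups

namespace Literature.NumberTheory.Rogawski1990

/-! ## §1 Two generic `2 × 2` identities for a matrix unitary for the antidiagonal form -/

section TwoByTwo

variable {K : Type*} [Field K] (σ : K →+* K)

/-- For `A ∈ M₂(K)` with `ᵗ(σA)·antidiag(1,1)·A = antidiag(1,1)`: `det A · σ(det A) = 1`. [cite: Rogawski1990, §3.1 p. 19] [cite: HornJohnson2013, §0.8.2] -/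
theorem det_mul_map_det_eq_one_of_unitary_antidiag (A : Matrix (Fin 2) (Fin 2) K)
    (hA : (A.map σ)ᵀ * (!![0, 1; 1, 0] : Matrix (Fin 2) (Fin 2) K) * A = !![0, 1; 1, 0]) : A.det * σ A.det = 1 := by
  have e00 := congrFun (congrFun hA 0) 0
  have e01 := congrFun (congrFun hA 0) 1
  have e10 := congrFun (congrFun hA 1) 0
  have e11 := congrFun (congrFun hA 1) 1
  simp [Matrix.mul_apply, Fin.sum_univ_two, Matrix.map_apply] at e00 e01 e10 e11
  rw [Matrix.det_fin_two, map_sub, map_mul, map_mul]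
  linear_combination (σ (A 1 1) * A 0 0 + σ (A 0 1) * A 1 0) * e01 + e10 - (σ (A 1 1) * A 0 1 + σ (A 0 1) * A 1 1) * e00

/-- For `A ∈ M₂(K)` with `ᵗ(σA)·antidiag(1,1)·A = antidiag(1,1)`: `σ(tr A) · det A = tr A` (`tr A⁻¹ = tr A ∕ det A` and `A⁻¹ = Φ⁻¹ ᵗ(σA) Φ`).
[cite: Rogawski1990, §3.1 p. 19] [cite: HornJohnson2013, §0.8.2] -/
theorem map_trace_mul_det_eq_trace_of_unitary_antidiag (A : Matrix (Fin 2) (Fin 2) K)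
    (hA : (A.map σ)ᵀ * (!![0, 1; 1, 0] : Matrix (Fin 2) (Fin 2) K) * A = !![0, 1; 1, 0]) : σ A.trace * A.det = A.trace := by
  have e00 := congrFun (congrFun hA 0) 0
  have e01 := congrFun (congrFun hA 0) 1
  have e10 := congrFun (congrFun hA 1) 0
  have e11 := congrFun (congrFun hA 1) 1
  simp [Matrix.mul_apply, Fin.sum_univ_two, Matrix.map_apply] at e00 e01 e10 e11
  rw [Matrix.trace_fin_two, Matrix.det_fin_two, map_add]
  linear_combination A 0 0 * e01 + A 1 1 * e10 - A 0 1 * e00 - A 1 0 * e11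

end TwoByTwo

/-! ## §2 Generic cubic algebra: `f = (X − u)(X² − tX + D)`, the action of the quadratic factor on a `u`-eigenvector -/

section Cubic

variable {K : Type*} [Field K]

/-- (D3)'s cubic tokens: `1·X³ − (t+u)X² + (D+tu)X − uD = (X − u)(X² − tX + D)`. [cite: HornJohnson2013, Thm. 2.4.3.2] -/
theorem cubic_tokens_eq (u t D : K) :
    (C 1 * X ^ 3 + C (-(t + u)) * X ^ 2 + C (D + t * u) * X + C (-(u * D)) : K[X]) = (X - C u) * (X ^ 2 - C t * X + C D) := by
  simp only [map_one, map_neg, map_add, map_mul, one_mul]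
  ring

/-- `coeff₂ ((X − u)(X² − tX + D)) = −(t + u)`. [cite: HornJohnson2013, Thm. 2.4.3.2] -/
theorem coeff_two_cubic (u t D : K) : ((X - C u) * (X ^ 2 - C t * X + C D) : K[X]).coeff 2 = -(t + u) := by
  rw [← cubic_tokens_eq]
  simp only [coeff_add, coeff_C_mul, coeff_X_pow, coeff_X, coeff_C]
  norm_num

/-- `coeff₁ ((X − u)(X² − tX + D)) = D + tu`. [cite: HornJohnson2013, Thm. 2.4.3.2] -/
theorem coeff_one_cubic (u t D : K) : ((X - C u) * (X ^ 2 - C t * X + C D) : K[X]).coeff 1 = D + t * u := by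
  rw [← cubic_tokens_eq]
  simp only [coeff_add, coeff_C_mul, coeff_X_pow, coeff_X, coeff_C]
  norm_num

/-- `coeff₂ (charpoly 1) = −3` in `M₃` (`tr 1 = 3 = −coeff₂`). [cite: HornJohnson2013, Thm. 2.4.3.2] -/
theorem coeff_two_charpoly_one : ((1 : Matrix (Fin 3) (Fin 3) K).charpoly).coeff 2 = -3 := by
  have h := Matrix.trace_eq_neg_charpoly_coeff (1 : Matrix (Fin 3) (Fin 3) K)
  rw [Matrix.trace_one, Fintype.card_fin] at h
  norm_num at h
  linear_combination h

/-- `χ(τ) x = χ(u) x` for a `u`-eigenvector `x` and the quadratic `χ = X² − tX + D`. [cite: HornJohnson2013, Thm. 1.1.6] -/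
theorem aeval_quadratic_mulVec_of_eigenvector (τ : Matrix (Fin 3) (Fin 3) K) {u : K} (t D : K) {x : Fin 3 → K} (hx : τ *ᵥ x = u • x) :
    aeval τ (X ^ 2 - C t * X + C D : K[X]) *ᵥ x = (u * u - t * u + D) • x := by
  have h2 : (τ * τ) *ᵥ x = (u * u) • x := by rw [← Matrix.mulVec_mulVec, hx, Matrix.mulVec_smul, hx, smul_smul]
  simp only [map_add, map_sub, map_mul, map_pow, aeval_X, aeval_C, Algebra.algebraMap_eq_smul_one, smul_mul_assoc, one_mul]
  rw [Matrix.add_mulVec, Matrix.sub_mulVec, pow_two, h2, Matrix.smul_mulVec, hx, Matrix.smul_mulVec, Matrix.one_mulVec,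
    smul_smul, ← sub_smul, ← add_smul]

end Cubic

/-! ## §3 A cyclic vector for a `3 × 3` matrix with square-free characteristic polynomial `(X − u)·χ`, `χ` an irreducible quadratic -/

section Cyclic

variable {K : Type*} [Field K]

/-- **Krylov criterion**: if `charpoly τ = (X − u)·χ` with `χ` irreducible quadratic, and `w` is neither a `u`-eigenvector nor killed by `χ(τ)`, then `(w, τw, τ²w)` is a
basis, i.e. `det Krylov(τ, w)` is a unit (the `gcd` of an annihilating polynomial of degree `≤ 2` with `(X − u)χ` is `1`, `X − u` or `χ` up to units).
[cite: HornJohnson2013, §3.3 (Thm. 3.3.15, non-derogatory matrices)] [cite: Lang2002, Ch. XIV §2 Thm. 2.1] -/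
theorem isUnit_det_krylov_of_not_eigen_of_aeval_ne (τ : Matrix (Fin 3) (Fin 3) K) {u : K} {χ : K[X]} (hχ : Irreducible χ) (hχ2 : χ.natDegree = 2)
    (hf : τ.charpoly = (X - C u) * χ) {w : Fin 3 → K} (h1 : τ *ᵥ w ≠ u • w) (h2 : aeval τ χ *ᵥ w ≠ 0) :
    IsUnit (Matrix.of fun i j : Fin 3 => ((τ ^ (j : ℕ)) *ᵥ w) i).det := by
  classical
  rw [isUnit_iff_ne_zero]
  intro hdet
  obtain ⟨c, hc0, hc⟩ := Matrix.exists_mulVec_eq_zero_iff.2 hdet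
  -- the annihilating polynomial `p = c₀ + c₁ X + c₂ X²`
  set p : K[X] := C (c 0) + C (c 1) * X + C (c 2) * X ^ 2 with hp
  have hpdeg : p.natDegree ≤ 2 := by
    refine (natDegree_add_le _ _).trans (max_le ((natDegree_add_le _ _).trans (max_le ?_ ?_)) ?_)
    · rw [natDegree_C]; exact Nat.zero_le _
    · exact (natDegree_C_mul_le _ _).trans (natDegree_X_le.trans (by norm_num))
    · exact (natDegree_C_mul_le _ _).trans (by rw [natDegree_X_pow])
  have hpcoeff : (fun j : Fin 3 => p.coeff j) = c := by
    funext j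
    fin_cases j <;> simp [hp, coeff_X, coeff_C, coeff_X_pow]
  have hp0 : p ≠ 0 := by
    intro h0
    apply hc0
    rw [← hpcoeff, h0]
    funext j; rw [coeff_zero]; rfl
  have hpw : aeval τ p *ᵥ w = 0 := by
    rw [Literature.NumberTheory.Automorphic.aeval_mulVec_eq_krylov_mulVec τ w (lt_of_le_of_lt hpdeg (by norm_num)), hpcoeff, hc]
  -- Cayley–Hamilton: `f(τ) = 0`
  have hfτ : aeval τ ((X - C u) * χ) = 0 := by rw [← hf]; exact Matrix.aeval_self_charpoly τ
  -- the gcd `d` of `p` and `f` kills `w`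
  set d : K[X] := EuclideanDomain.gcd p ((X - C u) * χ) with hd
  have hdw : aeval τ d *ᵥ w = 0 := by
    rw [hd, EuclideanDomain.gcd_eq_gcd_ab p ((X - C u) * χ), mul_comm p, map_add, map_mul, map_mul, hfτ, zero_mul, add_zero,
      ← Matrix.mulVec_mulVec, hpw, Matrix.mulVec_zero]
  have hdp : d ∣ p := EuclideanDomain.gcd_dvd_left _ _
  have hdf : d ∣ (X - C u) * χ := EuclideanDomain.gcd_dvd_right _ _
  have hd0 : d ≠ 0 := fun h0 => hp0 ((EuclideanDomain.gcd_eq_zero_iff.1 h0).1)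
  have hddeg : d.natDegree ≤ 2 := (natDegree_le_of_dvd hdp hp0).trans hpdeg
  have hXu0 : (X - C u : K[X]) ≠ 0 := X_sub_C_ne_zero u
  have hχ0 : χ ≠ 0 := hχ.ne_zero
  -- a unit `d = C r` kills `w` only if `w = 0`
  have hunit : ∀ {e : K[X]}, IsUnit e → aeval τ e *ᵥ w = 0 → w = 0 := by
    intro e he hew
    obtain ⟨r, hr, rfl⟩ := Polynomial.isUnit_iff.1 he
    rw [aeval_C, Algebra.algebraMap_eq_smul_one, Matrix.smul_mulVec, Matrix.one_mulVec] at hew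
    exact (smul_eq_zero.1 hew).resolve_left hr.ne_zero
  have hw0 : w ≠ 0 := by
    intro h0; apply h1; rw [h0, Matrix.mulVec_zero, smul_zero]
  by_cases hXd : (X - C u) ∣ d
  · -- `d = (X − u)·e` with `e ∣ χ`
    obtain ⟨e, he⟩ := hXd
    have heχ : e ∣ χ := by
      have : (X - C u) * e ∣ (X - C u) * χ := by rw [← he]; exact hdf
      exact (mul_dvd_mul_iff_left hXu0).1 this
    obtain ⟨g, hg⟩ := heχ
    rcases hχ.isUnit_or_isUnit hg with heu | hgu
    · -- `d ~ X − u`: `(τ − u) w = 0`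
      obtain ⟨r, hr, rfl⟩ := Polynomial.isUnit_iff.1 heu
      apply h1
      have h' : aeval τ ((X - C u) * C r) *ᵥ w = 0 := by rw [← he]; exact hdw
      rw [map_mul, aeval_C, Algebra.algebraMap_eq_smul_one, mul_smul_comm, mul_one, Matrix.smul_mulVec, map_sub, aeval_X, aeval_C,
        Algebra.algebraMap_eq_smul_one, Matrix.sub_mulVec, Matrix.smul_mulVec, Matrix.one_mulVec, smul_eq_zero] at h'
      exact sub_eq_zero.1 (h'.resolve_left hr.ne_zero)
    · -- `d ~ f`: degree `3 > 2`
      obtain ⟨r, hr, rfl⟩ := Polynomial.isUnit_iff.1 hgu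
      have he0 : e ≠ 0 := fun h0 => hχ0 (by rw [hg, h0, zero_mul])
      have hedeg : e.natDegree = 2 := by rw [← hχ2, hg, natDegree_mul_C hr.ne_zero]
      have hdeg3 : d.natDegree = 3 := by
        rw [he, natDegree_mul hXu0 he0, natDegree_X_sub_C, hedeg]
      omega
  · -- `d` coprime to `X − u`, so `d ∣ χ`
    have hcop : IsCoprime d (X - C u) := ((Polynomial.irreducible_X_sub_C u).coprime_iff_not_dvd.2 hXd).symm
    have hdχ : d ∣ χ := hcop.dvd_of_dvd_mul_left hdf
    obtain ⟨g, hg⟩ := hdχ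
    rcases hχ.isUnit_or_isUnit hg with hdu | hgu
    · exact hw0 (hunit hdu hdw)
    · obtain ⟨r, hr, rfl⟩ := Polynomial.isUnit_iff.1 hgu
      apply h2
      rw [hg, mul_comm, map_mul, ← Matrix.mulVec_mulVec, hdw, Matrix.mulVec_zero]

/-- If `charpoly τ = (X − u)·χ` with `χ(u) ≠ 0` and `deg χ = 2`, `χ` monic, then `τ ≠ u·1`: some vector is not a `u`-eigenvector. [cite: HornJohnson2013, §1.1] -/
theorem exists_mulVec_ne_smul_of_charpoly (τ : Matrix (Fin 3) (Fin 3) K) {u : K} {χ : K[X]} (hχu : ¬ χ.IsRoot u)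
    (hf : τ.charpoly = (X - C u) * χ) : ∃ a : Fin 3 → K, τ *ᵥ a ≠ u • a := by
  by_contra hall
  push Not at hall
  have hτ : τ = Matrix.diagonal fun _ : Fin 3 => u := by
    refine Matrix.ext_of_mulVec_single fun i => ?_
    rw [hall]; ext k; simp [Matrix.mulVec_diagonal, Pi.single_apply]
  have hcp : τ.charpoly = (X - C u) ^ 3 := by
    rw [hτ, Matrix.charpoly_diagonal, Finset.prod_const, Finset.card_univ, Fintype.card_fin]
  rw [hf, pow_succ', mul_right_inj' (X_sub_C_ne_zero u)] at hcp
  apply hχu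
  rw [hcp, IsRoot, eval_pow, eval_sub, eval_X, eval_C, sub_self, zero_pow two_ne_zero]

end Cyclic

/-! ## §4 The hermitian value on a `u`-eigenline is non-zero (the eigenline of a unitary `τ` with `χ_g(u) ≠ 0` is non-isotropic) -/

section Isotropy

variable {K : Type*} [Field K] (σ : K →+* K)

/-- **NON-ISOTROPY OF THE `u`-EIGENLINE.**  `τ` unitary for the invertible form `J` (`ᵗ(στ)Jτ = J`), `σu·u = 1`, `P := τ² − tτ + D = p qᵀ` of rank `≤ 1` with
`χ(u) = u² − tu + D ≠ 0`, and `x = q_j · p ≠ 0` a `u`-eigenvector (a column of `P`): then `x* J x ≠ 0` — the row `ℓ = (σx)ᵀJ` is a left `u`-eigenvector, `ℓP = χ(u)ℓ = (ℓ·p) qᵀ`,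
so `ℓ·x = 0` would force `ℓ = 0`. [cite: Rogawski1990, §3.5 Prop. 3.5.2 (c) p. 29; §4.3 p. 43] -/
theorem hermitian_value_eigenvector_ne_zero (J τ : Matrix (Fin 3) (Fin 3) K) (hJ : J.det ≠ 0) (hτ : (τ.map σ)ᵀ * J * τ = J)
    {u t D : K} (hu : σ u * u = 1) (hχu : u * u - t * u + D ≠ 0)
    {p q : Fin 3 → K} (hP : τ * τ - t • τ + D • (1 : Matrix (Fin 3) (Fin 3) K) = Matrix.vecMulVec p q) (j : Fin 3)
    (hx0 : (fun i => p i * q j) ≠ 0) (hx : τ *ᵥ (fun i => p i * q j) = u • (fun i => p i * q j)) :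
    ∑ i : Fin 3, ∑ k : Fin 3, σ (p i * q j) * J i k * (p k * q j) ≠ 0 := by
  set x : Fin 3 → K := fun i => p i * q j with hxdef
  set ℓ : Fin 3 → K := Matrix.vecMul (fun i => σ (x i)) J with hℓ
  -- `ℓ` is a left `u`-eigenvector
  have hσx : (fun i => σ ((τ *ᵥ x) i)) = (τ.map σ) *ᵥ fun i => σ (x i) := by
    funext i; exact RingHom.map_mulVec σ τ x i
  have hℓτ : Matrix.vecMul ℓ τ = u • ℓ := by
    have h1 : Matrix.vecMul (fun i => σ (x i)) ((τ.map σ)ᵀ * J * τ) = ℓ := by rw [hτ]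
    rw [← Matrix.vecMul_vecMul, ← Matrix.vecMul_vecMul, Matrix.vecMul_transpose, ← hσx, hx] at h1
    have h2 : (fun i => σ ((u • x) i)) = σ u • fun i => σ (x i) := by
      funext i; simp [Pi.smul_apply, smul_eq_mul, map_mul]
    rw [h2, Matrix.smul_vecMul, Matrix.smul_vecMul] at h1
    -- `h1 : σ u • (ℓ ᵥ* τ) = ℓ`
    calc Matrix.vecMul ℓ τ = (u * σ u) • Matrix.vecMul ℓ τ := by rw [mul_comm, hu, one_smul]
      _ = u • ℓ := by rw [← smul_smul, h1]
  -- `ℓ P = χ(u) ℓ = (ℓ · p) q`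
  have hℓP : Matrix.vecMul ℓ (τ * τ - t • τ + D • (1 : Matrix (Fin 3) (Fin 3) K)) = (u * u - t * u + D) • ℓ := by
    rw [Matrix.vecMul_add, Matrix.vecMul_sub, ← Matrix.vecMul_vecMul, hℓτ, Matrix.smul_vecMul, hℓτ, Matrix.vecMul_smul, hℓτ,
      Matrix.vecMul_smul, Matrix.vecMul_one, smul_smul, smul_smul, ← sub_smul, ← add_smul]
  rw [hP, Matrix.vecMul_vecMulVec] at hℓP
  -- the value is `ℓ · x = q_j (ℓ · p)`
  have hval : ∑ i : Fin 3, ∑ k : Fin 3, σ (p i * q j) * J i k * (p k * q j) = q j * (ℓ ⬝ᵥ p) := by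
    simp only [hℓ, Matrix.vecMul, dotProduct, Finset.sum_mul, Finset.mul_sum, hxdef]
    rw [Finset.sum_comm]
    exact Finset.sum_congr rfl fun k _ => Finset.sum_congr rfl fun i _ => by ring
  rw [hval]
  have hqj : q j ≠ 0 := by
    intro h0; apply hx0; funext i; simp [hxdef, h0]
  intro hzero
  have hℓp : ℓ ⬝ᵥ p = 0 := (mul_eq_zero.1 hzero).resolve_left hqj
  rw [hℓp, zero_smul] at hℓP
  have hℓ0 : ℓ = 0 := (smul_eq_zero.1 hℓP.symm).resolve_left hχu
  have hσx0 : (fun i => σ (x i)) = 0 := Matrix.eq_zero_of_vecMul_eq_zero hJ hℓ0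
  apply hx0
  funext i
  have := congrFun hσx0 i
  simpa using this

end Isotropy

end Literature.NumberTheory.Rogawski1990

end
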